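import Summits.PneNP.PneNP.Theses.ExpanderLinearGenerators
import Literature.Computability.MetaComplexity.FregeMod
import Literature.Computability.MetaComplexity.Frege
import Literature.Computability.MetaComplexity.FpLinearSystems
import HarnessLib

/-!
# The unsolvability hypothesis of `LinearGeneratorModPFregeHard` is idle (item stmt-PneNP-11444)

Route `PneNP/ExpanderLinearGenerators`, crux `LinearGeneratorModPFregeHard` (the `AC⁰[p]`-Frege
rung).  A small structural observation for the planner and the refuters: the crux assumes the
system `E` UNSOLVABLE before quantifying over `F_d(MOD_p)`-proofs `π` of `¬ sumEncoding 1 E`.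
That hypothesis does no work: `textbookFrege(MOD_p)` is SOUND
(`isSound_textbookFrege`, `IsSound.isTautology_of_isModProofOf`), so when `E` is solvable the
target `¬ sumEncoding 1 E` is not a tautology (`sumEncoding_satisfiable_iff`) and has no proof at
all — the conclusion holds vacuously.  Hence

* `not_isModDepthProofOf_of_systemSat` — a solvable system's negated XOR-CNF has no
  `F_d(MOD_a)`-proof in `textbookFrege`, for any `a`, `d`;
* `linearGeneratorModPFregeHard_iff_dropUnsat` — the crux is EQUIVALENT to the same statement
  with the hypothesis `¬ SystemSat E univ` deleted.

(The same remark applies verbatim to the depth-`d` Frege crux `LinearGeneratorDepthFregeHard`;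
unsolvability matters only for NON-VACUITY, i.e. for the existence of proofs `π`, which the
calibration files establish separately.)

References: S. Buss, R. Impagliazzo, J. Krajíček, P. Pudlák, A. Razborov, J. Sgall, Comput.
Complexity 6 (1996/97), Def. 1.1 [BussImpagliazzoKrajicekPudlakRazborovSgall1997]; S. Cook,
R. Reckhow, JSL 44 (1979) §2 (soundness) [CookReckhow1979].
-/

noncomputable section

set_option linter.dupNamespace false -- `Summit.PneNP.PneNP.…`: summit = sub-problem (D-0017)

namespace Summit.PneNP.PneNP.Theorems

open Literature.Computability.Complexity Literature.Computability.MetaComplexity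

/-- **No sound proof of a falsifiable formula**: if `E` is solvable then the negation of its
XOR-CNF `sumEncoding 1 E` has no `textbookFrege(MOD_a)` proof of any depth.
[Buss et al. 1997, Def. 1.1 (soundness); Cook–Reckhow 1979, §2] [folklore] -/
theorem not_isModDepthProofOf_of_systemSat {a n m : ℕ} (E : Fin m → LinEqMod 2 n)
    (hsat : SystemSat E Finset.univ) (d : ℕ) (π : List (PropFormMod a ℕ)) :
    ¬ textbookFrege.IsModDepthProofOf d π
      (PropFormMod.ofPropForm (PropForm.neg (PropForm.ofCNF (sumEncoding 1 E)))) := by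
  intro hπ
  obtain ⟨σ, hσ⟩ := (sumEncoding_satisfiable_iff (p := 2) (B := 1) (by norm_num) Nat.one_pos E).2 hsat
  have htaut := isSound_textbookFrege.isTautology_of_isModProofOf hπ.1 σ
  rw [PropFormMod.eval_ofPropForm] at htaut
  change (!(PropForm.ofCNF (sumEncoding 1 E)).eval σ) = true at htaut
  rw [PropForm.eval_ofCNF, hσ] at htaut
  exact Bool.false_ne_true htaut

open Summit.PneNP.PneNP.Theses.ExpanderLinearGenerators in
/-- **The unsolvability hypothesis of the crux is idle.** `LinearGeneratorModPFregeHard` is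
equivalent to the statement obtained by deleting `¬ SystemSat E univ`: for solvable `E` there are
no proofs `π` to bound (soundness), so the conclusion is vacuous there.
[Buss et al. 1997, Def. 1.1; Cook–Reckhow 1979, §2] [folklore] -/
theorem linearGeneratorModPFregeHard_iff_dropUnsat :
    LinearGeneratorModPFregeHard ↔
      ∀ (p : ℕ), p.Prime → p ≠ 2 → ∀ (ℓ d : ℕ) (δ : ℝ), 1 ≤ ℓ → 0 < δ → δ < 1 →
        ∃ ε : ℝ, 0 < ε ∧ ∃ N : ℕ, ∀ n : ℕ, N ≤ n → ∀ (m : ℕ) (E : Fin m → LinEqMod 2 n),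
          (∀ i, (E i).supp.card ≤ ℓ) →
          IsBoundaryExpander (fun i => (E i).supp.map Fin.valEmbedding) ((n : ℝ) ^ (1 - δ))
            (3 / 4 * ℓ) →
          ∀ π : List (PropFormMod p ℕ), textbookFrege.IsModDepthProofOf d π
            (PropFormMod.ofPropForm (PropForm.neg (PropForm.ofCNF (sumEncoding 1 E)))) →
            (2 : ℝ) ^ ((n : ℝ) ^ ε) ≤ (modProofSize π : ℝ) := by
  constructor
  · intro h p hp hp2 ℓ d δ hℓ hδ0 hδ1
    obtain ⟨ε, hε, N, hN⟩ := h p hp hp2 ℓ d δ hℓ hδ0 hδ1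
    refine ⟨ε, hε, N, fun n hn m E hsparse hexp π hπ => ?_⟩
    by_cases hsat : SystemSat E Finset.univ
    · exact absurd hπ (not_isModDepthProofOf_of_systemSat E hsat d π)
    · exact hN n hn m E hsparse hexp hsat π hπ
  · intro h p hp hp2 ℓ d δ hℓ hδ0 hδ1
    obtain ⟨ε, hε, N, hN⟩ := h p hp hp2 ℓ d δ hℓ hδ0 hδ1
    exact ⟨ε, hε, N, fun n hn m E hsparse hexp _ π hπ => hN n hn m E hsparse hexp π hπ⟩

end Summit.PneNP.PneNP.Theorems
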